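import Mathlib
import Literature.Dynamics.ConleyIndex.PolyfacialBlock
import HarnessLib

/-!
# Internal tangencies break the Ważewski hypothesis
# (crux stmt-AnomalousDissipation-10352, `WazewskiBlock.UniformGalerkinTrap`, line `Sketch`)

The bet of the line `Sketch` (`Cruxes/UniformGalerkinTrap/Lines/Sketch.lean`, `stub_wazewskiBlock`) asks, at every
large Galerkin level and every small viscosity, that the immediate exit set `B⁻` of the three-face block `B` be
CLOSED (and that `B` not retract onto it).  This support file isolates the abstract obstruction used by the lead to
refute that hypothesis at given parameters: an **internal tangency** — a point of `B` whose forward orbit stays in `B`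
for a while (so it is not an immediate exit point) but which is a limit of immediate exit points — forces `B⁻` to be
NOT closed.  With the first-order exit criterion (an active face with negative flow-derivative exits immediately,
`stub_exitClosed_aux_neg_of_deriv_neg`, landed with the stub `stub_exitClosed_of_transversal`) this becomes the
checkable recipe `not_isClosed_immediateExitSet_of_tangency`: exhibit a block point `x` on an active face, a sequence of
block points on the same face with negative face-derivative converging to `x`, and a positive stay time for `x`.

* `face_neg_of_deriv_neg` — an active face of negative derivative becomes negative just after time `0` (mean value
  theorem; the structure-free form of the tree's `IsRegularPolyfacial.face_neg_of_deriv_neg`).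
* `mem_immediateExitSet_of_deriv_neg` — first-order exit points of `faceSet h ∩ M` (no transversality needed).
* `not_isClosed_immediateExitSet_of_stay_of_mem_closure` — the abstract obstruction.
* `not_isClosed_immediateExitSet_of_tangency` — the recipe (sequence form).

References: C. Conley, *Isolated Invariant Sets and the Morse Index*, CBMS 38 (1978), Ch. II §2 (internal tangencies
and isolating blocks); T. Ważewski, Ann. Soc. Polon. Math. 20 (1947); P. Hartman, *ODE*, Ch. X §3 (egress points).
-/

-- `Summit.<Summit>.<Problem>` is the tree's mandated summit-side namespace (CONVENTIONS §2); deliberate duplicate.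
set_option linter.dupNamespace false

namespace Summit.AnomalousDissipation.AnomalousDissipation.Theorems.UniformGalerkinTrap.Sketch

open Set Filter Topology
open Literature.Dynamics.ConleyIndex

variable {X : Type*} [TopologicalSpace X] {φ : ℝ → X → X}

/-- **An active face with negative derivative becomes negative just after time `0`.** For a continuous semiflow `φ`,
a continuous face `g` whose derivative along the orbit of `x` at every `t > 0` is `e (φ t x)` with `e` continuous:
if `g x = 0` and `e x < 0` then `g (φ s x) < 0` for all `s ∈ (0, ε]`, some `ε > 0` (right-continuity of
`s ↦ e (φ s x)` at `0`, then strict antitonicity on `[0, ε]` by the mean value theorem). [folklore] -/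
theorem face_neg_of_deriv_neg (hφ : IsSemiflow φ) {g e : X → ℝ} (hg : Continuous g) (he : Continuous e) {x : X}
    (hder : ∀ t : ℝ, 0 < t → HasDerivAt (fun s => g (φ s x)) (e (φ t x)) t)
    (h0 : g x = 0) (hneg : e x < 0) : ∃ ε > 0, ∀ s ∈ Ioc 0 ε, g (φ s x) < 0 := by
  have hc : ContinuousWithinAt (fun s => e (φ s x)) (Ici 0) 0 :=
    he.continuousAt.comp_continuousWithinAt (hφ.continuousWithinAt_orbit x le_rfl)
  have hneg' : e (φ 0 x) < 0 := by rwa [hφ.map_zero]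
  have hev : ∀ᶠ s in 𝓝[Ici (0 : ℝ)] 0, e (φ s x) < 0 := hc (isOpen_Iio.mem_nhds hneg')
  rw [nhdsWithin, eventually_inf_principal, Metric.eventually_nhds_iff] at hev
  obtain ⟨ε, hε, hball⟩ := hev
  have hanti : StrictAntiOn (fun s => g (φ s x)) (Icc 0 (ε / 2)) := by
    refine strictAntiOn_of_deriv_neg (convex_Icc _ _) ?_ fun s hs => ?_
    · exact hg.comp_continuousOn ((hφ.continuousOn_orbit x).mono fun s hs => hs.1)
    · rw [interior_Icc] at hs
      rw [(hder s hs.1).deriv]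
      refine hball ?_ hs.1.le
      rw [Real.dist_eq, sub_zero, abs_of_pos hs.1]
      linarith [hs.2]
  refine ⟨ε / 2, by positivity, fun s hs => ?_⟩
  have hlt := hanti (left_mem_Icc.2 (by positivity)) ⟨hs.1.le, hs.2⟩ hs.1
  simpa [hφ.map_zero, h0] using hlt

/-- **First-order exit points** of a polyfacial set cut by an arbitrary set `M`: a point of `faceSet h ∩ M` with an
active face `h i x = 0` of negative flow-derivative `d i x < 0` leaves `faceSet h ∩ M` immediately (it leaves
`faceSet h` already).  No transversality and no hypothesis on `M` are needed. [folklore] -/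
theorem mem_immediateExitSet_of_deriv_neg (hφ : IsSemiflow φ) {ι : Type*} {h d : ι → X → ℝ} {M : Set X}
    (hh : ∀ i, Continuous (h i)) (hd : ∀ i, Continuous (d i))
    (hder : ∀ i x t, 0 < t → HasDerivAt (fun s => h i (φ s x)) (d i (φ t x)) t)
    {x : X} (hx : x ∈ faceSet h ∩ M) {i : ι} (hi : h i x = 0) (hneg : d i x < 0) :
    x ∈ immediateExitSet φ (faceSet h ∩ M) := by
  obtain ⟨ε, hε, hout⟩ := face_neg_of_deriv_neg hφ (hh i) (hd i) (x := x)
    (fun t ht => hder i x t ht) hi hneg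
  refine ⟨hx, fun δ hδ => ⟨min (ε / 2) (δ / 2), ⟨by positivity, ?_⟩, fun hmem => ?_⟩⟩
  · exact (min_le_right _ _).trans_lt (by linarith)
  · have hle : min (ε / 2) (δ / 2) ≤ ε := (min_le_left _ _).trans (by linarith)
    have hlt := hout _ ⟨by positivity, hle⟩
    exact absurd (hmem.1 i) (not_le.2 hlt)

/-- **Internal tangencies break closedness of the exit set (abstract form).** If a point of `W` stays in `W` for all
times in some `(0, δ)` (so it is NOT an immediate exit point) but lies in the closure of the immediate exit set, then
the immediate exit set of `W` is not closed. [folklore] -/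
theorem not_isClosed_immediateExitSet_of_stay_of_mem_closure {W : Set X} {x : X}
    (hstay : ∃ δ > 0, ∀ t ∈ Ioo 0 δ, φ t x ∈ W) (hcl : x ∈ closure (immediateExitSet φ W)) :
    ¬ IsClosed (immediateExitSet φ W) := by
  intro hclosed
  rw [hclosed.closure_eq] at hcl
  obtain ⟨δ, hδ, hin⟩ := hstay
  obtain ⟨t, ht, hout⟩ := hcl.2 δ hδ
  exact hout (hin t ht)

/-- **The refutation recipe for the Ważewski hypothesis of a polyfacial block.** Let `φ` be a continuous semiflow,
`h i` continuous faces with continuous flow-derivatives `d i`, `M` any set.  If a point `x` of `faceSet h ∩ M` stays in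
`faceSet h ∩ M` for all times in some `(0, δ)` and is the limit of points `u n ∈ faceSet h ∩ M` having an active face
`h i (u n) = 0` with `d i (u n) < 0` (first-order exit points), then the immediate exit set of `faceSet h ∩ M` is NOT
closed — `x` is an internal tangency.  This is how the lead refutes `stub_wazewskiBlock` at given
`(f, E, ε₀, ν, G, N)`: `x = a f + s V₁` on the work face with `Ẇ(x) = 0 < Ẅ(x)`, `u n = a f + (1 + 1/n) s V₁`.
(Closed `∀`-form: registered sub-goal of stmt-AnomalousDissipation-10352.) [cite: Conley1978, Ch. II §2] -/
theorem not_isClosed_immediateExitSet_of_tangency :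
    ∀ {X : Type} [TopologicalSpace X] {ι : Type} (φ : ℝ → X → X) (h d : ι → X → ℝ) (M : Set X) (x : X),
      IsSemiflow φ → (∀ i, Continuous (h i)) → (∀ i, Continuous (d i)) →
      (∀ i y t, 0 < t → HasDerivAt (fun s => h i (φ s y)) (d i (φ t y)) t) →
      (∃ δ > 0, ∀ t ∈ Set.Ioo 0 δ, φ t x ∈ faceSet h ∩ M) →
      (∃ u : ℕ → X, Tendsto u atTop (𝓝 x) ∧
        ∀ n, u n ∈ faceSet h ∩ M ∧ ∃ i, h i (u n) = 0 ∧ d i (u n) < 0) →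
      ¬ IsClosed (immediateExitSet φ (faceSet h ∩ M)) := by
  intro X _ ι φ h d M x hφ hh hd hder hstay hseq
  refine not_isClosed_immediateExitSet_of_stay_of_mem_closure hstay ?_
  obtain ⟨u, hu, hun⟩ := hseq
  refine mem_closure_of_tendsto hu (Eventually.of_forall fun n => ?_)
  obtain ⟨hmem, i, hi, hneg⟩ := hun n
  exact mem_immediateExitSet_of_deriv_neg hφ hh hd hder hmem hi hneg

end Summit.AnomalousDissipation.AnomalousDissipation.Theorems.UniformGalerkinTrap.Sketch
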